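import Mathlib.MeasureTheory.Integral.MeanInequalities
import Mathlib.MeasureTheory.Integral.Prod
import Mathlib.MeasureTheory.Function.LpSeminorm.Basic
import HarnessLib

/-!
# Minkowski's integral inequality

The continuous form of Minkowski's inequality ("the norm of an integral is at most the integral of
the norms" for the `L^p` norm in a second variable): for `1 ≤ p < ∞`, σ-finite measures `μ` on `α`,
`ν` on `β`, and a jointly measurable `f ≥ 0`,

  `(∫_x (∫_y f (x, y) dν)^p dμ)^{1/p} ≤ ∫_y (∫_x f (x, y)^p dμ)^{1/p} dν`

(`Literature.Analysis.FunctionSpaces.rpow_inv_lintegral_rpow_lintegral_le`, `ℝ≥0∞`-valued; a.e.-measurable version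
`Literature.Analysis.FunctionSpaces.rpow_inv_lintegral_rpow_lintegral_le'`), and the consequence for Bochner integrals of vector-valued
functions

  `‖x ↦ ∫_y F (x, y) dν‖_{L^p(μ)} ≤ ∫_y ‖F (·, y)‖_{L^p(μ)} dν`

(`Literature.Analysis.FunctionSpaces.eLpNorm_integral_le_lintegral_eLpNorm`). Mathlib has the two-function Minkowski inequality
(`ENNReal.lintegral_Lp_add_le`) and Hölder's inequality (`ENNReal.lintegral_mul_le_Lp_mul_Lq`), from
which the integral form is derived here by the classical duality-free argument: with
`F (x) = ∫_y f (x, y)` and `A = ∫ F^p`, Tonelli and Hölder give `A = ∫_y ∫_x f (x, y) F(x)^{p-1} ≤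
(∫_y ‖f (·, y)‖_p) A^{1/q}`, whence `A^{1/p} ≤ ∫_y ‖f (·, y)‖_p` when `A < ∞`; the general case follows
by monotone convergence along the truncations `min (f, n) 1_{E_n × G_n}` (`E_n`, `G_n` spanning sets
of finite measure). Everything in this file is proved. (The tree's
`Literature.Analysis.FunctionSpaces.lintegral_rpow_lintegral_le`, `SobolevDomainProofs.lean`, is the weaker Jensen form for a
probability measure `ν`, without the outer `1/p`-th roots.)

This is the inequality that controls `‖∫₀ᵗ K_{t-s} ∗ M_s ds‖_{L^p_x} ≤ ∫₀ᵗ ‖K_{t-s} ∗ M_s‖_{L^p_x} ds`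
in Kato's `L^p` theory of the Navier–Stokes equations (Lemarié-Rieusset 2016, Prop. 7.3; Kato 1984).

## References

* E. M. Stein, *Singular Integrals and Differentiability Properties of Functions* (1970),
  Appendix A.1 ("Minkowski's inequality for integrals"). [cite: SteinSingularIntegrals1970, App. A.1]
* G. H. Hardy, J. E. Littlewood, G. Pólya, *Inequalities*, Thm. 202 (the integral analogue of
  Minkowski's inequality). [folklore]
-/

noncomputable section

open MeasureTheory Filter Topology Function Set
open scoped ENNReal NNReal

namespace Literature.Analysis.FunctionSpaces

variable {α β : Type*} [MeasurableSpace α] [MeasurableSpace β] {μ : Measure α} {ν : Measure β}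

/-! ## The finite case -/

section Finite

variable [SFinite μ] [SFinite ν]

/-- **Minkowski's integral inequality, finite case.** For conjugate exponents `1 < p, q < ∞`, a
jointly measurable `f : α → β → ℝ≥0∞` and `A = ∫_x (∫_y f)^p < ∞`:
`A^{1/p} ≤ ∫_y (∫_x f (x, y)^p)^{1/p}` (Tonelli + Hölder: `A ≤ (∫_y ‖f(·,y)‖_p) A^{1/q}`).
Stein 1970, App. A.1. [cite: SteinSingularIntegrals1970, App. A.1] -/
theorem rpow_inv_lintegral_rpow_lintegral_le_of_ne_top {p q : ℝ} (hpq : p.HolderConjugate q)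
    {f : α → β → ℝ≥0∞} (hf : Measurable (uncurry f))
    (hA : ∫⁻ x, (∫⁻ y, f x y ∂ν) ^ p ∂μ ≠ ∞) :
    (∫⁻ x, (∫⁻ y, f x y ∂ν) ^ p ∂μ) ^ (1 / p) ≤ ∫⁻ y, (∫⁻ x, f x y ^ p ∂μ) ^ (1 / p) ∂ν := by
  set F : α → ℝ≥0∞ := fun x => ∫⁻ y, f x y ∂ν with hF
  have hFm : Measurable F := hf.lintegral_prod_right'
  set A : ℝ≥0∞ := ∫⁻ x, F x ^ p ∂μ with hAdef
  set R : ℝ≥0∞ := ∫⁻ y, (∫⁻ x, f x y ^ p ∂μ) ^ (1 / p) ∂ν with hR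
  have hp0 : 0 < p := hpq.pos
  have hq0 : 0 < q := hpq.symm.pos
  have hp1 : 0 < p - 1 := hpq.sub_one_pos
  by_cases hA0 : A = 0
  · rw [hA0, ENNReal.zero_rpow_of_pos (by positivity)]
    exact zero_le
  have hfy : ∀ y, Measurable fun x => f x y := fun y => hf.comp measurable_prodMk_right
  have hfx : ∀ x, Measurable fun y => f x y := fun x => hf.comp measurable_prodMk_left
  have hRm : Measurable fun y => (∫⁻ x, f x y ^ p ∂μ) ^ (1 / p) :=
    ((hf.pow_const p).lintegral_prod_left').pow_const _
  -- the key estimate `A ≤ R * A^{1/q}`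
  have key : A ≤ R * A ^ (1 / q) := by
    calc A = ∫⁻ x, F x * F x ^ (p - 1) ∂μ := by
          refine lintegral_congr fun x => ?_
          conv_lhs => rw [show p = 1 + (p - 1) by ring]
          rw [ENNReal.rpow_add_of_nonneg _ _ zero_le_one hp1.le, ENNReal.rpow_one]
      _ = ∫⁻ x, ∫⁻ y, f x y * F x ^ (p - 1) ∂ν ∂μ := by
          refine lintegral_congr fun x => ?_
          rw [lintegral_mul_const _ (hfx x)]
      _ = ∫⁻ y, ∫⁻ x, f x y * F x ^ (p - 1) ∂μ ∂ν :=
          lintegral_lintegral_swap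
            ((hf.mul ((hFm.pow_const (p - 1)).comp measurable_fst)).aemeasurable)
      _ ≤ ∫⁻ y, (∫⁻ x, f x y ^ p ∂μ) ^ (1 / p) * (∫⁻ x, (F x ^ (p - 1)) ^ q ∂μ) ^ (1 / q) ∂ν := by
          refine lintegral_mono fun y => ?_
          have h := ENNReal.lintegral_mul_le_Lp_mul_Lq μ hpq (hfy y).aemeasurable
            (hFm.pow_const (p - 1)).aemeasurable
          simpa only [Pi.mul_apply] using h
      _ = R * A ^ (1 / q) := by
          rw [lintegral_mul_const _ hRm]
          congr 2
          refine lintegral_congr fun x => ?_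
          rw [← ENNReal.rpow_mul, hpq.sub_one_mul_conj]
  -- divide by `A^{1/q}`
  have hA1 : A = A ^ (1 / p) * A ^ (1 / q) := by
    rw [← ENNReal.rpow_add_of_nonneg _ _ (by positivity) (by positivity), one_div, one_div,
      hpq.inv_add_inv_eq_one, ENNReal.rpow_one]
  have hAq0 : A ^ (1 / q) ≠ 0 := by
    intro h
    rw [ENNReal.rpow_eq_zero_iff] at h
    rcases h with ⟨h0, -⟩ | ⟨-, hneg⟩
    · exact hA0 h0
    · exact absurd hneg (not_lt.2 (by positivity))
  have hAqt : A ^ (1 / q) ≠ ∞ := ENNReal.rpow_ne_top_of_nonneg (by positivity) hA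
  have key' : A ^ (1 / p) * A ^ (1 / q) ≤ R * A ^ (1 / q) := by rwa [← hA1]
  exact (ENNReal.mul_le_mul_iff_left hAq0 hAqt).1 key'

end Finite

/-! ## The general case -/

section General

variable [SigmaFinite μ] [SigmaFinite ν]

/-- `min a n → a` along `ℕ` in `ℝ≥0∞`. [folklore] -/
theorem tendsto_min_natCast (a : ℝ≥0∞) : Tendsto (fun n : ℕ => min a n) atTop (𝓝 a) := by
  rcases eq_or_ne a ∞ with rfl | ha
  · simp only [le_top, min_eq_right]
    exact ENNReal.tendsto_nat_nhds_top
  · obtain ⟨N, hN⟩ := ENNReal.exists_nat_gt ha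
    refine tendsto_atTop_of_eventually_const (i₀ := N) fun n hn => ?_
    exact min_eq_left (hN.le.trans (by exact_mod_cast hn))

/-- **Minkowski's integral inequality** (`ℝ≥0∞` form). For `1 ≤ p`, σ-finite `μ`, `ν` and a jointly
measurable `f : α → β → ℝ≥0∞`:
`(∫_x (∫_y f (x, y) dν)^p dμ)^{1/p} ≤ ∫_y (∫_x f (x, y)^p dμ)^{1/p} dν`.
(For `p = 1` this is Tonelli with equality; for `p > 1` the finite case
`Literature.Analysis.FunctionSpaces.rpow_inv_lintegral_rpow_lintegral_le_of_ne_top` applied to the truncations `min (f, n) 1_{E_n × G_n}` and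
monotone convergence.) Stein 1970, App. A.1. [cite: SteinSingularIntegrals1970, App. A.1] -/
theorem rpow_inv_lintegral_rpow_lintegral_le {p : ℝ} (hp : 1 ≤ p) {f : α → β → ℝ≥0∞}
    (hf : Measurable (uncurry f)) :
    (∫⁻ x, (∫⁻ y, f x y ∂ν) ^ p ∂μ) ^ (1 / p) ≤ ∫⁻ y, (∫⁻ x, f x y ^ p ∂μ) ^ (1 / p) ∂ν := by
  rcases hp.eq_or_lt with rfl | hp1
  · simp only [ENNReal.rpow_one, div_one]
    rw [lintegral_lintegral_swap hf.aemeasurable]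
  have hpq := Real.HolderConjugate.conjExponent hp1
  have hp0 : 0 < p := zero_lt_one.trans hp1
  -- truncations
  set E : ℕ → Set α := spanningSets μ with hE
  set G : ℕ → Set β := spanningSets ν with hG
  set fn : ℕ → α → β → ℝ≥0∞ := fun n x y =>
    (E n).indicator (fun _ => (1 : ℝ≥0∞)) x * ((G n).indicator (fun _ => (1 : ℝ≥0∞)) y * min (f x y) n)
    with hfn
  have hEm : ∀ n, MeasurableSet (E n) := measurableSet_spanningSets μ
  have hGm : ∀ n, MeasurableSet (G n) := measurableSet_spanningSets ν
  have hfn_meas : ∀ n, Measurable (uncurry (fn n)) := fun n =>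
    ((measurable_const.indicator (hEm n)).comp measurable_fst).mul
      (((measurable_const.indicator (hGm n)).comp measurable_snd).mul (hf.min measurable_const))
  have hind_le : ∀ (s : Set α) (x : α), s.indicator (fun _ => (1 : ℝ≥0∞)) x ≤ 1 := fun s x => by
    by_cases hx : x ∈ s <;> simp [hx]
  have hind_le' : ∀ (s : Set β) (y : β), s.indicator (fun _ => (1 : ℝ≥0∞)) y ≤ 1 := fun s y => by
    by_cases hy : y ∈ s <;> simp [hy]
  have hfn_le : ∀ n x y, fn n x y ≤ f x y := by
    intro n x y
    calc fn n x y ≤ 1 * (1 * f x y) := by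
          simp only [hfn]
          gcongr
          · exact hind_le _ _
          · exact hind_le' _ _
          · exact min_le_left _ _
      _ = f x y := by rw [one_mul, one_mul]
  have hfn_mono : ∀ x y, Monotone fun n => fn n x y := by
    intro x y m n hmn
    simp only [hfn]
    gcongr
    · exact monotone_spanningSets μ hmn
    · exact monotone_spanningSets ν hmn
  have hEtend : ∀ x : α, Tendsto (fun n => (E n).indicator (fun _ => (1 : ℝ≥0∞)) x) atTop (𝓝 1) := by
    intro x
    have hx : x ∈ ⋃ n, E n := by rw [hE, iUnion_spanningSets μ]; exact mem_univ x
    obtain ⟨N, hN⟩ := mem_iUnion.1 hx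
    refine tendsto_atTop_of_eventually_const (i₀ := N) fun n hn => ?_
    rw [indicator_of_mem (monotone_spanningSets μ hn hN)]
  have hGtend : ∀ y : β, Tendsto (fun n => (G n).indicator (fun _ => (1 : ℝ≥0∞)) y) atTop (𝓝 1) := by
    intro y
    have hy : y ∈ ⋃ n, G n := by rw [hG, iUnion_spanningSets ν]; exact mem_univ y
    obtain ⟨N, hN⟩ := mem_iUnion.1 hy
    refine tendsto_atTop_of_eventually_const (i₀ := N) fun n hn => ?_
    rw [indicator_of_mem (monotone_spanningSets ν hn hN)]
  have hfn_tendsto : ∀ x y, Tendsto (fun n => fn n x y) atTop (𝓝 (f x y)) := by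
    intro x y
    have hin := ENNReal.Tendsto.mul (hGtend y) (Or.inl one_ne_zero) (tendsto_min_natCast (f x y))
      (Or.inr ENNReal.one_ne_top)
    have h := ENNReal.Tendsto.mul (hEtend x) (Or.inl one_ne_zero) hin (Or.inr ENNReal.one_ne_top)
    simpa only [hfn, one_mul] using h
  -- the truncated `A_n` are finite
  have hAn : ∀ n, ∫⁻ x, (∫⁻ y, fn n x y ∂ν) ^ p ∂μ ≠ ∞ := by
    intro n
    set c : ℝ≥0∞ := (n : ℝ≥0∞) * ν (G n) with hc
    have hct : c < ∞ := ENNReal.mul_lt_top (ENNReal.natCast_lt_top n) (measure_spanningSets_lt_top ν n)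
    have h1 : ∀ x, ∫⁻ y, fn n x y ∂ν ≤ (E n).indicator (fun _ => (1 : ℝ≥0∞)) x * c := by
      intro x
      calc ∫⁻ y, fn n x y ∂ν
          ≤ ∫⁻ y, (E n).indicator (fun _ => (1 : ℝ≥0∞)) x * (G n).indicator (fun _ => (n : ℝ≥0∞)) y ∂ν := by
            refine lintegral_mono fun y => ?_
            simp only [hfn]
            gcongr
            by_cases hy : y ∈ G n
            · simp only [hy, indicator_of_mem, one_mul]
              exact min_le_right _ _
            · simp [hy]
        _ = (E n).indicator (fun _ => (1 : ℝ≥0∞)) x * c := by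
            rw [lintegral_const_mul _ (measurable_const.indicator (hGm n)),
              lintegral_indicator_const (hGm n), hc]
    have h2 : ∀ x, (∫⁻ y, fn n x y ∂ν) ^ p ≤ (E n).indicator (fun _ => c ^ p) x := by
      intro x
      refine (ENNReal.rpow_le_rpow (h1 x) hp0.le).trans (le_of_eq ?_)
      by_cases hx : x ∈ E n
      · simp [hx]
      · simp [hx, ENNReal.zero_rpow_of_pos hp0]
    refine ne_top_of_le_ne_top ?_ (lintegral_mono h2)
    rw [lintegral_indicator_const (hEm n)]
    exact (ENNReal.mul_lt_top (ENNReal.rpow_lt_top_of_nonneg hp0.le hct.ne)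
      (measure_spanningSets_lt_top μ n)).ne
  -- monotone convergence on the left-hand side
  have hlim : Tendsto (fun n => ∫⁻ x, (∫⁻ y, fn n x y ∂ν) ^ p ∂μ) atTop
      (𝓝 (∫⁻ x, (∫⁻ y, f x y ∂ν) ^ p ∂μ)) := by
    refine lintegral_tendsto_of_tendsto_of_monotone
      (fun n => ((hfn_meas n).lintegral_prod_right'.pow_const p).aemeasurable)
      (ae_of_all _ fun x m n hmn => ?_) (ae_of_all _ fun x => ?_)
    · exact ENNReal.rpow_le_rpow (lintegral_mono fun y => hfn_mono x y hmn) hp0.le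
    · have hin : Tendsto (fun n => ∫⁻ y, fn n x y ∂ν) atTop (𝓝 (∫⁻ y, f x y ∂ν)) :=
        lintegral_tendsto_of_tendsto_of_monotone
          (fun n => ((hfn_meas n).comp measurable_prodMk_left).aemeasurable)
          (ae_of_all _ fun y => hfn_mono x y) (ae_of_all _ fun y => hfn_tendsto x y)
      exact (ENNReal.continuous_rpow_const.tendsto _).comp hin
  have hbound : ∀ n, (∫⁻ x, (∫⁻ y, fn n x y ∂ν) ^ p ∂μ) ^ (1 / p) ≤
      ∫⁻ y, (∫⁻ x, f x y ^ p ∂μ) ^ (1 / p) ∂ν := fun n =>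
    (rpow_inv_lintegral_rpow_lintegral_le_of_ne_top hpq (hfn_meas n) (hAn n)).trans
      (lintegral_mono fun y => ENNReal.rpow_le_rpow
        (lintegral_mono fun x => ENNReal.rpow_le_rpow (hfn_le n x y) hp0.le) (by positivity))
  exact le_of_tendsto' ((ENNReal.continuous_rpow_const.tendsto _).comp hlim) hbound

/-- **Minkowski's integral inequality**, a.e.-measurable form: as
`Literature.Analysis.FunctionSpaces.rpow_inv_lintegral_rpow_lintegral_le` for `f` merely a.e.-measurable on `μ × ν` (replace `f` by a
measurable modification; both sides only see a.e. sections). [cite: SteinSingularIntegrals1970, App. A.1] -/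
theorem rpow_inv_lintegral_rpow_lintegral_le' {p : ℝ} (hp : 1 ≤ p) {f : α → β → ℝ≥0∞}
    (hf : AEMeasurable (uncurry f) (μ.prod ν)) :
    (∫⁻ x, (∫⁻ y, f x y ∂ν) ^ p ∂μ) ^ (1 / p) ≤ ∫⁻ y, (∫⁻ x, f x y ^ p ∂μ) ^ (1 / p) ∂ν := by
  set g : α × β → ℝ≥0∞ := hf.mk (uncurry f) with hg
  have hgm : Measurable g := hf.measurable_mk
  have hfg : uncurry f =ᵐ[μ.prod ν] g := hf.ae_eq_mk
  have h1 : ∀ᵐ x ∂μ, ∀ᵐ y ∂ν, f x y = g (x, y) := Measure.ae_ae_of_ae_prod hfg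
  have h2 : ∀ᵐ y ∂ν, ∀ᵐ x ∂μ, f x y = g (x, y) := by
    have hswap := (Measure.measurePreserving_swap (μ := ν) (ν := μ)).quasiMeasurePreserving.ae_eq_comp hfg
    exact Measure.ae_ae_of_ae_prod hswap
  have hL : ∫⁻ x, (∫⁻ y, f x y ∂ν) ^ p ∂μ = ∫⁻ x, (∫⁻ y, g (x, y) ∂ν) ^ p ∂μ := by
    refine lintegral_congr_ae ?_
    filter_upwards [h1] with x hx
    rw [lintegral_congr_ae hx]
  have hR : ∫⁻ y, (∫⁻ x, f x y ^ p ∂μ) ^ (1 / p) ∂ν = ∫⁻ y, (∫⁻ x, g (x, y) ^ p ∂μ) ^ (1 / p) ∂ν := by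
    refine lintegral_congr_ae ?_
    filter_upwards [h2] with y hy
    have hy' : (fun x => f x y ^ p) =ᵐ[μ] fun x => g (x, y) ^ p := by
      filter_upwards [hy] with x hx
      rw [hx]
    rw [lintegral_congr_ae hy']
  rw [hL, hR]
  exact rpow_inv_lintegral_rpow_lintegral_le hp (f := fun x y => g (x, y)) hgm

/-- **Minkowski's integral inequality for Bochner integrals**: for `1 ≤ p < ∞`, σ-finite `μ`, `ν`,
and `F : α → β → E'` jointly a.e.-strongly measurable,
`‖x ↦ ∫_y F (x, y) dν‖_{L^p(μ)} ≤ ∫_y ‖F (·, y)‖_{L^p(μ)} dν` (in `ℝ≥0∞`; no integrability hypotheses —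
non-integrable sections contribute the junk value `0` on the left only). Stein 1970, App. A.1.
[cite: SteinSingularIntegrals1970, App. A.1] -/
theorem eLpNorm_integral_le_lintegral_eLpNorm {E' : Type*} [NormedAddCommGroup E'] [NormedSpace ℝ E']
    {F : α → β → E'} (hF : AEStronglyMeasurable (uncurry F) (μ.prod ν)) {p : ℝ≥0∞} (hp1 : 1 ≤ p)
    (hp : p ≠ ∞) :
    eLpNorm (fun x => ∫ y, F x y ∂ν) p μ ≤ ∫⁻ y, eLpNorm (fun x => F x y) p μ ∂ν := by
  have hp0 : p ≠ 0 := (zero_lt_one.trans_le hp1).ne'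
  have hpr : 1 ≤ p.toReal := by
    have h := ENNReal.toReal_mono hp hp1
    rwa [ENNReal.toReal_one] at h
  simp only [eLpNorm_eq_lintegral_rpow_enorm_toReal hp0 hp]
  calc (∫⁻ x, ‖∫ y, F x y ∂ν‖ₑ ^ p.toReal ∂μ) ^ (1 / p.toReal)
      ≤ (∫⁻ x, (∫⁻ y, ‖F x y‖ₑ ∂ν) ^ p.toReal ∂μ) ^ (1 / p.toReal) := by
        refine ENNReal.rpow_le_rpow (lintegral_mono fun x => ?_) (by positivity)
        exact ENNReal.rpow_le_rpow (enorm_integral_le_lintegral_enorm _) (by positivity)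
    _ ≤ ∫⁻ y, (∫⁻ x, ‖F x y‖ₑ ^ p.toReal ∂μ) ^ (1 / p.toReal) ∂ν :=
        rpow_inv_lintegral_rpow_lintegral_le' hpr (f := fun x y => ‖F x y‖ₑ) hF.enorm

end General

end Literature.Analysis.FunctionSpaces
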